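import Summits.QuantumFields.YangMills.Theorems.UnitScaleTiltProp7CovBlockGaussIntPairing
import Summits.QuantumFields.YangMills.Theorems.UnitScaleTiltProp7BlockLineCount
import HarnessLib

/-!
# Route `UnitScaleTilt`, crux K1 «MinimiserStabilityRegPr» (stmt-QuantumFields-19200), route-R E′ S3 K-form engine, row (P′) ∕ hXb — «INT-CS»:
# the interior part of the Gauss composite, `Σ_y ⟨φ₀(c_y), INT(y)⟩ = Σ_y Σ_{int bonds} ⟨D_VΨ_y, B⟩` (✓ `Prop7CovBlockGaussIntPairing.re_trace_int_eq_sum_covD_pairing`), BOOKED by one weighted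
# Cauchy–Schwarz into the Dirichlet energy of the axial local models on the blocks' interior bonds (hDir's currency) and the HS mass of `B`:
# `2|Σ_y ⟨φ_c(y), INT(y)⟩| ≤ θ⁻¹·ℓ·DIR_int(Ψ) + θ·ℓ⁻¹·M_HS(B)` for every `θ, ℓ > 0` — no multiplicity table, no curvature estimate

Cell `ym3-torus`, width seat `ym3-torus-px15` (gen 3); third brick of the hXb-inhabitant lane opened by «BLOCK-GAUSS» (★ym-ust-19200-p1 g16 WORD 10 (2)).  THEOREMS ONLY (0 `def`, 0 `sorry`,
0 `instance`); `--supports stmt-QuantumFields-19200`, count-neutral.  YM₃ on T³ is a ladder rung (R3), not the Clay problem; nothing here claims a stub, the crux, d = 4 or the mass gap.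

WHAT IS PROVED (ns `…Theorems.Prop7CovBlockGaussIntCS`; `M_N(ℂ)`, HS letters `Σ_jk ‖X j k‖²` of ✓ `Prop7TracePairing`).
* §1 `two_mul_abs_sum_re_trace_le` — `2|Σ_{i∈s} Re tr((X i)ᴴ K i)| ≤ θ·Σ_i|X i|²_HS + θ⁻¹·Σ_i|K i|²_HS` (✓ `two_mul_abs_re_trace_le` summed).
* §2 `sum_interior_hs_le_mass` — the HS mass of `B` over the interior bonds of all `k`-blocks is at most its total HS mass (✓ `Prop7BlockLineCount.sum_site_eq_sum_fibreSite`);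
  `sum_hs_le_card_mul_sum_opNorm_sq` — HS ≤ `N`·op² for a finite family (the seam to ✓p679008's op-norm `DIR` letter).
* §3 `two_mul_abs_sum_le`, `two_mul_abs_sum_sum_sum_le` (real bookkeeping), ★★★ `two_mul_abs_int_pairing_le` — for unitary-valued `V`, centre values `φ_c : Site P k → M_N(ℂ)`, any bond field `B`, any `θ, ℓ > 0`:
  `2·|Σ_y Re tr((φ_c y)ᴴ·INT(y))| ≤ θ⁻¹·ℓ·Σ_yΣ_μΣ_{r_μ+1<L^k}|D_{V,μ}Ψ_{φ_c y}(x_r)|²_HS + θ·ℓ⁻¹·Σ_xΣ_μ|B_μ(x)|²_HS`, `INT(y)` = ✓p680339's interior term at the centre-based axial combs VERBATIM,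
  `Ψ_m(z) = R(axialT V c_y z)⁻¹ m`.
HONEST SCOPE.  Bookkeeping (triangle inequality, weighted AM–GM per bond, a sub-sum of nonnegative terms); no estimate of `D_VΨ` itself — that is the displayed Dirichlet row (hDir ⟸ hKg′-K(fam),
✓p680787) for the family the knit chooses; the junction `J_VH` and the face piece are elsewhere.

References: T. Bałaban, CMP 102 (1985) 277–309 [Balaban1985Variational] ((135) p.298, Prop. 7 p.299); CMP 99 (1985) 389–434 [Balaban1985BackgroundPropagators] ((3.3)–(3.5) pp.390–391);
CMP 102 (1985) 255–275 [Balaban1985UV3] ((27) p.263); CMP 95 (1984) 17–40 [Balaban1984PropagatorsI] ((1.18)–(1.21) pp.20–21).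
-/

set_option autoImplicit false

noncomputable section

open scoped BigOperators Matrix Matrix.Norms.L2Operator

namespace Summit.QuantumFields.YangMills.Theorems.Prop7CovBlockGaussIntCS

open Literature.MathematicalPhysics.QuantumFieldTheory.Balaban1983to89
open Finset
open B9Eq39Adjoint (R covD)
open B9TorusCalculus (torusT)
open B10Eq27TorusAxialLog (axialT)
open B15DeterminingSets (embIter)
open B7Prop2Explicit (unitaryUnits)
open Summit.QuantumFields.YangMills.Theorems.Prop7CovariantCoercivity (two_mul_abs_re_trace_le sum_norm_sq_le_mul_opNorm_sq)
open Summit.QuantumFields.YangMills.Theorems.Prop7BlockLineCount (sum_site_eq_sum_fibreSite)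
open Summit.QuantumFields.YangMills.Theorems.Prop7CovBlockGaussIntPairing (re_trace_int_eq_sum_covD_pairing)

variable {N : ℕ}

/-! ## §1 Weighted Cauchy–Schwarz for a finite family of HS pairings -/

/-- `2|Σ_{i∈s} Re tr((X i)ᴴ·K i)| ≤ θ·Σ_i Σ_jk‖X i j k‖² + θ⁻¹·Σ_i Σ_jk‖K i j k‖²` (`θ > 0`). [cite: Balaban1985Variational, (135) p.298] -/
theorem two_mul_abs_sum_re_trace_le {ι : Type*} (s : Finset ι) {θ : ℝ} (hθ : 0 < θ) (X K : ι → Matrix (Fin N) (Fin N) ℂ) :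
    2 * |∑ i ∈ s, (((X i)ᴴ * K i).trace).re|
      ≤ θ * ∑ i ∈ s, ∑ j : Fin N, ∑ k : Fin N, ‖X i j k‖ ^ 2 + θ⁻¹ * ∑ i ∈ s, ∑ j : Fin N, ∑ k : Fin N, ‖K i j k‖ ^ 2 := by
  calc 2 * |∑ i ∈ s, (((X i)ᴴ * K i).trace).re|
      ≤ 2 * ∑ i ∈ s, |(((X i)ᴴ * K i).trace).re| := by
        have := Finset.abs_sum_le_sum_abs (fun i => (((X i)ᴴ * K i).trace).re) s
        linarith
    _ = ∑ i ∈ s, 2 * |(((X i)ᴴ * K i).trace).re| := by rw [Finset.mul_sum]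
    _ ≤ ∑ i ∈ s, (θ * ∑ j : Fin N, ∑ k : Fin N, ‖X i j k‖ ^ 2 + θ⁻¹ * ∑ j : Fin N, ∑ k : Fin N, ‖K i j k‖ ^ 2) :=
        Finset.sum_le_sum fun i _ => two_mul_abs_re_trace_le hθ (X i) (K i)
    _ = θ * ∑ i ∈ s, ∑ j : Fin N, ∑ k : Fin N, ‖X i j k‖ ^ 2 + θ⁻¹ * ∑ i ∈ s, ∑ j : Fin N, ∑ k : Fin N, ‖K i j k‖ ^ 2 := by
        rw [Finset.sum_add_distrib, Finset.mul_sum, Finset.mul_sum]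

/-! ## §2 The interior HS mass of a bond field is at most its total HS mass; HS versus operator norm -/

section Mass

variable {P : Params} {k : ℕ}

/-- The HS mass of `B` over the INTERIOR bonds `(x_r, x_r + e_μ) ⊂ B(y)` of all `k`-blocks is at most the total HS mass `Σ_x Σ_μ |B_μ(x)|²_HS` (every fine site is `x_r` for exactly one
`(y, r)`, ✓ `sum_site_eq_sum_fibreSite`; the interior filter drops nonnegative terms). [cite: Balaban1984PropagatorsI, (1.18) p.20] -/
theorem sum_interior_hs_le_mass (h : P.sitesPerDir 0 = P.L ^ k * P.sitesPerDir k) (B : Fin P.d → Site P 0 → Matrix (Fin N) (Fin N) ℂ) :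
    ∑ y : Site P k, ∑ μ : Fin P.d, ∑ r ∈ univ.filter (fun r : Fin P.d → Fin (P.L ^ k) => (r μ : ℕ) + 1 < P.L ^ k),
        ∑ j : Fin N, ∑ l : Fin N, ‖B μ (Site.fibreSite 0 k y r) j l‖ ^ 2
      ≤ ∑ x : Site P 0, ∑ μ : Fin P.d, ∑ j : Fin N, ∑ l : Fin N, ‖B μ x j l‖ ^ 2 := by
  rw [sum_site_eq_sum_fibreSite h (fun x => ∑ μ : Fin P.d, ∑ j : Fin N, ∑ l : Fin N, ‖B μ x j l‖ ^ 2)]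
  refine Finset.sum_le_sum fun y _ => ?_
  calc ∑ μ : Fin P.d, ∑ r ∈ univ.filter (fun r : Fin P.d → Fin (P.L ^ k) => (r μ : ℕ) + 1 < P.L ^ k),
          ∑ j : Fin N, ∑ l : Fin N, ‖B μ (Site.fibreSite 0 k y r) j l‖ ^ 2
      ≤ ∑ μ : Fin P.d, ∑ r : Fin P.d → Fin (P.L ^ k), ∑ j : Fin N, ∑ l : Fin N, ‖B μ (Site.fibreSite 0 k y r) j l‖ ^ 2 :=
        Finset.sum_le_sum fun μ _ => Finset.sum_le_sum_of_subset_of_nonneg (Finset.filter_subset _ _) fun r _ _ => by positivity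
    _ = ∑ r : Fin P.d → Fin (P.L ^ k), ∑ μ : Fin P.d, ∑ j : Fin N, ∑ l : Fin N, ‖B μ (Site.fibreSite 0 k y r) j l‖ ^ 2 := Finset.sum_comm

/-- HS ≤ `N`·op² for a finite family: `Σ_{i∈s} Σ_jk‖X i j k‖² ≤ N·Σ_{i∈s} ‖X i‖²` (✓ `sum_norm_sq_le_mul_opNorm_sq` summed) — the seam from this file's HS Dirichlet energy to the op-norm `DIR`
letter of ✓ `Prop7RowHOfLocalModelRowsPt`. [folklore] -/
theorem sum_hs_le_card_mul_sum_opNorm_sq {ι : Type*} (s : Finset ι) (X : ι → Matrix (Fin N) (Fin N) ℂ) :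
    ∑ i ∈ s, ∑ j : Fin N, ∑ l : Fin N, ‖X i j l‖ ^ 2 ≤ N * ∑ i ∈ s, ‖X i‖ ^ 2 := by
  rw [Finset.mul_sum]
  exact Finset.sum_le_sum fun i _ => sum_norm_sq_le_mul_opNorm_sq (X i)

end Mass

/-! ## §3 The booking of the interior part of the Gauss composite -/

/-- `2|Σ_i f i| ≤ Σ_i 2|f i|`. [folklore] -/
theorem two_mul_abs_sum_le {ι : Type*} (s : Finset ι) (f : ι → ℝ) : 2 * |∑ i ∈ s, f i| ≤ ∑ i ∈ s, 2 * |f i| := by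
  rw [← Finset.mul_sum]
  have := Finset.abs_sum_le_sum_abs f s
  linarith

/-- Real bookkeeping: per-`(y, μ)` weighted Cauchy–Schwarz bounds sum to the triple-sum bound. [folklore] -/
theorem two_mul_abs_sum_sum_sum_le {α β γ : Type*} (sy : Finset α) (sμ : Finset β) (sr : β → Finset γ) (a DX MB : α → β → γ → ℝ) {t : ℝ}
    (hcs : ∀ y ∈ sy, ∀ μ ∈ sμ, 2 * |∑ r ∈ sr μ, a y μ r| ≤ t * ∑ r ∈ sr μ, DX y μ r + t⁻¹ * ∑ r ∈ sr μ, MB y μ r) :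
    2 * |∑ y ∈ sy, ∑ μ ∈ sμ, ∑ r ∈ sr μ, a y μ r|
      ≤ t * ∑ y ∈ sy, ∑ μ ∈ sμ, ∑ r ∈ sr μ, DX y μ r + t⁻¹ * ∑ y ∈ sy, ∑ μ ∈ sμ, ∑ r ∈ sr μ, MB y μ r := by
  calc 2 * |∑ y ∈ sy, ∑ μ ∈ sμ, ∑ r ∈ sr μ, a y μ r|
      ≤ ∑ y ∈ sy, 2 * |∑ μ ∈ sμ, ∑ r ∈ sr μ, a y μ r| := two_mul_abs_sum_le sy _
    _ ≤ ∑ y ∈ sy, ∑ μ ∈ sμ, 2 * |∑ r ∈ sr μ, a y μ r| := Finset.sum_le_sum fun y _ => two_mul_abs_sum_le sμ _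
    _ ≤ ∑ y ∈ sy, ∑ μ ∈ sμ, (t * ∑ r ∈ sr μ, DX y μ r + t⁻¹ * ∑ r ∈ sr μ, MB y μ r) :=
        Finset.sum_le_sum fun y hy => Finset.sum_le_sum fun μ hμ => hcs y hy μ hμ
    _ = t * ∑ y ∈ sy, ∑ μ ∈ sμ, ∑ r ∈ sr μ, DX y μ r + t⁻¹ * ∑ y ∈ sy, ∑ μ ∈ sμ, ∑ r ∈ sr μ, MB y μ r := by
        simp only [Finset.sum_add_distrib, Finset.mul_sum]

section Booking

variable {P : Params} {k : ℕ} (hk : k ≤ P.m + P.K) (h : P.sitesPerDir 0 = P.L ^ k * P.sitesPerDir k)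
  {V : GaugeField P 0 (Matrix (Fin N) (Fin N) ℂ)ˣ} (hV : ∀ b, V b ∈ unitaryUnits (Matrix (Fin N) (Fin N) ℂ))

include hk h hV in
/-- ★★★ **INT-CS — THE INTERIOR PART OF hXb IS BOOKED BY THE DIRICHLET ENERGY OF THE AXIAL LOCAL MODELS AND THE MASS OF `B`.**  For unitary-valued `V`, centre values `φ_c`, any bond
field `B` and any `θ, ℓ > 0`:
`2·|Σ_y Re tr((φ_c y)ᴴ·INT(y))| ≤ θ⁻¹·ℓ·Σ_yΣ_μΣ_{r_μ+1<L^k} |D_{V,μ}Ψ_{φ_c y}(x_r)|²_HS + θ·ℓ⁻¹·Σ_xΣ_μ |B_μ(x)|²_HS`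
(`INT(y)` = the interior term of ✓ `Prop7CovBlockGauss.block_sum_R_divB_eq` at `T := axialT V (embIter k y) ∘ fibreSite`, `U_μ(x) := V⟨x,μ⟩`; `Ψ_m(z) = R(axialT V c_y z)⁻¹ m`).
[cite: Balaban1985Variational, (135) p.298, Prop. 7 p.299; Balaban1985UV3, (27) p.263; Balaban1985BackgroundPropagators, (3.3)-(3.5) pp.390-391] -/
theorem two_mul_abs_int_pairing_le {θ ℓ : ℝ} (hθ : 0 < θ) (hℓ : 0 < ℓ)
    (φc : Site P k → Matrix (Fin N) (Fin N) ℂ) (B : Fin P.d → Site P 0 → Matrix (Fin N) (Fin N) ℂ) :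
    2 * |∑ y : Site P k, (((φc y)ᴴ * ∑ μ : Fin P.d, ∑ r ∈ univ.filter (fun r : Fin P.d → Fin (P.L ^ k) => (r μ : ℕ) + 1 < P.L ^ k),
        R (axialT V (embIter k y) (Site.fibreSite 0 k y r))
          (R ((axialT V (embIter k y) (Site.fibreSite 0 k y r))⁻¹
                * axialT V (embIter k y) (Site.fibreSite 0 k y (Function.update r μ ⟨min ((r μ : ℕ) + 1) (P.L ^ k - 1), by have := (r μ).isLt; omega⟩))
                * (V ⟨Site.fibreSite 0 k y r, μ⟩)⁻¹) (B μ (Site.fibreSite 0 k y r)) - B μ (Site.fibreSite 0 k y r))).trace).re|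
      ≤ θ⁻¹ * ℓ * ∑ y : Site P k, ∑ μ : Fin P.d, ∑ r ∈ univ.filter (fun r : Fin P.d → Fin (P.L ^ k) => (r μ : ℕ) + 1 < P.L ^ k),
            ∑ j : Fin N, ∑ l : Fin N, ‖(covD (torusT P 0) (fun κ z => V ⟨z, κ⟩) μ (fun z => R (axialT V (embIter k y) z)⁻¹ (φc y)) (Site.fibreSite 0 k y r)) j l‖ ^ 2
        + θ * ℓ⁻¹ * ∑ x : Site P 0, ∑ μ : Fin P.d, ∑ j : Fin N, ∑ l : Fin N, ‖B μ x j l‖ ^ 2 := by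
  have hθ' : 0 < θ⁻¹ * ℓ := mul_pos (inv_pos.mpr hθ) hℓ
  have hinv : (θ⁻¹ * ℓ)⁻¹ = θ * ℓ⁻¹ := by rw [mul_inv, inv_inv]
  -- the identity per block
  rw [Finset.sum_congr rfl fun y _ => re_trace_int_eq_sum_covD_pairing hk h hV y B (φc y)]
  -- per (y, μ) weighted Cauchy–Schwarz, summed
  have hb := two_mul_abs_sum_sum_sum_le (Finset.univ : Finset (Site P k)) (Finset.univ : Finset (Fin P.d))
    (fun μ => univ.filter (fun r : Fin P.d → Fin (P.L ^ k) => (r μ : ℕ) + 1 < P.L ^ k))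
    (fun y μ r => (((covD (torusT P 0) (fun κ z => V ⟨z, κ⟩) μ (fun z => R (axialT V (embIter k y) z)⁻¹ (φc y)) (Site.fibreSite 0 k y r))ᴴ
              * B μ (Site.fibreSite 0 k y r)).trace).re)
    (fun y μ r => ∑ j : Fin N, ∑ l : Fin N, ‖(covD (torusT P 0) (fun κ z => V ⟨z, κ⟩) μ (fun z => R (axialT V (embIter k y) z)⁻¹ (φc y)) (Site.fibreSite 0 k y r)) j l‖ ^ 2)
    (fun y μ r => ∑ j : Fin N, ∑ l : Fin N, ‖B μ (Site.fibreSite 0 k y r) j l‖ ^ 2)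
    (t := θ⁻¹ * ℓ) (fun y _ μ _ => two_mul_abs_sum_re_trace_le _ hθ' _ _)
  refine hb.trans (add_le_add le_rfl ?_)
  rw [hinv]
  exact mul_le_mul_of_nonneg_left (sum_interior_hs_le_mass h B) (by positivity)

end Booking

end Summit.QuantumFields.YangMills.Theorems.Prop7CovBlockGaussIntCS

end
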